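import Summits.QuantumFields.YangMills.Theorems.FluctuationComparisonRegPrIntLS2BetaMlogMixedDifference
import Summits.QuantumFields.YangMills.Theorems.FluctuationComparisonRegPrIntLS2BetaCouplingIdentity
import Literature.MathematicalPhysics.QuantumFieldTheory.Balaban1983to89.BlockAveragingExpMeanLog
import HarnessLib

/-!
# S2β · `hFlat` road, brick (G6) of UV3-NODE §57.8 (C)(2) — THE COUPLING COST OF A WORD OF MEANS: G4 (mixed differences of `log(P·eᵃ·B)`)
# fed into G5 (the coupling identity) — «coupling two consecutive slots costs 512·s·(mean fluctuation of the context slot)», generic and in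
# `SU(N)`∕`dist1` clothes

Cell `ym3-torus` (rung R3 = continuum `SU(2)` Yang–Mills on the three-torus — NOT d = 4, NOT infinite volume, NOT a mass gap, NOT Clay).
Width seat «width 8» `ym3-torus-px8` (gen 21), FREE px helper on crux `stmt-QuantumFields-20520`, count-neutral, DEFINITION-FREE.

WHY.  ✓`…EmlMemberTransportMeanContext` turns `log(word of averaged bonds)` into the mean over INDEPENDENT member indices of `log(member word)`;
✓`…CouplingIdentity` says the passage to COUPLED indices (member paths continue, comb hairpins collapse) costs the triple mean of mixed second
differences; ✓`…MlogMixedDifference` bounds each of those by `256·‖ΔP‖·‖Δa‖`.  This file composes the three for the two-slot functional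
`Φ i j = mean_k log(P_i · e^{a_j} · B_k)` (context `P_i` from slot 1, member `a_j` of slot 2, an inner mean over the still-independent rest `k`):
* §1 `norm_mixedDiff_mean_le` — mixed differences pass through an inner mean;
* §2 ★ `norm_mixedDiff_wordMean_le` — `‖Δ_iΔ_j Φ‖ ≤ 256·‖P_i − P_{i′}‖·‖a_j − a_{j′}‖`; ★★ `norm_coupled_sub_indep_wordMean_le` — for EVERY bijection `σ` and
  EVERY centre `c`: `‖n⁻¹Σ_i Φ i (σ i) − n⁻²Σ_{i,j} Φ i j‖ ≤ 512·s·(n⁻¹Σ_i ‖P_i − c‖)` (`‖a_j − a_{j′}‖ ≤ s`) — chargeable (mean fluctuation) × small (size);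
* §3 ★★ `norm_coupled_sub_indep_wordMean_SU_le` — the same for `P_i = U_i·S`, `e^{a_j} = W_j` in `SU(N)` with `dist1 (U_i·S) ≤ 1∕20`, `dist1 W_j ≤ ρ ≤ 1∕41`,
  `‖B_k − 1‖ ≤ 1∕20`: `≤ 1024·(ρ∕(1−ρ))·(n⁻¹Σ_i ‖U_i − c‖)` (right multiplication by the unitary `S` is an isometry).

HONEST SCOPE.  Composition of three landed helper files; constants admissible, not optimal; nothing of Bałaban's analysis; the nonabelian KEY LEMMA, the
recursion, `hFlat`, TUBE-REG∘, GAP♯∘, S2β, crux 20520 and `YM3TorusSU2` are NOT proved; no registered stub is closed; the Yang–Mills mass gap is NOT proved.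
References: T. Bałaban, CMP **109** (1987) [Balaban1987RG1] ((0.4)–(0.8) p.253); W. Rossmann, *Lie Groups* (OUP 2002) §1.3 [Rossmann2002].
-/

set_option autoImplicit false

noncomputable section

open NormedSpace Finset
open scoped BigOperators Matrix.Norms.L2Operator

namespace Summit.QuantumFields.YangMills.Theorems.FluctuationComparisonRegPrIntLS2BetaCouplingCost

open Literature.MathematicalPhysics.QuantumFieldTheory.Balaban1983to89
open Literature.MathematicalPhysics.QuantumFieldTheory.Balaban1983to89.MatrixLog (mlog exp_mlog norm_mlog_le_div)
open Summit.QuantumFields.YangMills.Theorems.FluctuationComparisonRegPrIntLS2BetaMlogMixedDifference (norm_mixedDiff_mlog_le)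
open Summit.QuantumFields.YangMills.Theorems.FluctuationComparisonRegPrIntLS2BetaCouplingIdentity (norm_mean_coupled_sub_mean_indep_le)

/-! ## §1 Mixed differences pass through an inner mean -/

section Mean

variable {κ : Type*} [Fintype κ] {V : Type*} [NormedAddCommGroup V] [NormedSpace ℝ V]

/-- If `‖f₁ k − f₂ k − f₃ k + f₄ k‖ ≤ M` for every `k`, the same holds for the uniform means over `k`. [folklore] -/
theorem norm_mixedDiff_mean_le [Nonempty κ] (f₁ f₂ f₃ f₄ : κ → V) {M : ℝ} (h : ∀ k, ‖f₁ k - f₂ k - f₃ k + f₄ k‖ ≤ M) :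
    ‖((Fintype.card κ : ℝ))⁻¹ • ∑ k, f₁ k - ((Fintype.card κ : ℝ))⁻¹ • ∑ k, f₂ k - ((Fintype.card κ : ℝ))⁻¹ • ∑ k, f₃ k +
        ((Fintype.card κ : ℝ))⁻¹ • ∑ k, f₄ k‖ ≤ M := by
  have hc : (0 : ℝ) < Fintype.card κ := Nat.cast_pos.mpr Fintype.card_pos
  have e : ((Fintype.card κ : ℝ))⁻¹ • ∑ k, f₁ k - ((Fintype.card κ : ℝ))⁻¹ • ∑ k, f₂ k - ((Fintype.card κ : ℝ))⁻¹ • ∑ k, f₃ k +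
        ((Fintype.card κ : ℝ))⁻¹ • ∑ k, f₄ k = ((Fintype.card κ : ℝ))⁻¹ • ∑ k, (f₁ k - f₂ k - f₃ k + f₄ k) := by
    simp only [Finset.sum_add_distrib, Finset.sum_sub_distrib, smul_add, smul_sub]
  rw [e, norm_smul, norm_inv, Real.norm_of_nonneg hc.le]
  calc ((Fintype.card κ : ℝ))⁻¹ * ‖∑ k, (f₁ k - f₂ k - f₃ k + f₄ k)‖ ≤ ((Fintype.card κ : ℝ))⁻¹ * ∑ _k : κ, M :=
        mul_le_mul_of_nonneg_left ((norm_sum_le _ _).trans (Finset.sum_le_sum fun k _ => h k)) (inv_nonneg.mpr hc.le)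
    _ = M := by rw [Finset.sum_const, Finset.card_univ, nsmul_eq_mul, inv_mul_cancel_left₀ hc.ne']

end Mean

/-! ## §2 The coupling cost of a two-slot word mean (Banach algebra) -/

section Banach

variable {𝔸 : Type*} [NormedRing 𝔸] [NormedAlgebra ℂ 𝔸] [CompleteSpace 𝔸] [NormOneClass 𝔸]
variable {ι κ : Type*} [Fintype ι] [Fintype κ]

omit [Fintype ι] in
/-- ★ **MIXED DIFFERENCES OF THE WORD FUNCTIONAL** `Φ i j = mean_k log(P_i·e^{a_j}·B_k)` on the ball `‖P_i − 1‖, ‖a_j‖, ‖B_k − 1‖ ≤ 1∕20`: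
`‖Φ i j − Φ i j′ − Φ i′ j + Φ i′ j′‖ ≤ 256·‖P_i − P_{i′}‖·‖a_j − a_{j′}‖` (✓`norm_mixedDiff_mlog_le` through the inner mean).
[cite: Rossmann2002, §1.3 Theorem 1, remark after (5)] -/
theorem norm_mixedDiff_wordMean_le [Nonempty κ] (P a : ι → 𝔸) (B : κ → 𝔸) (Φ : ι → ι → 𝔸)
    (hΦ : ∀ i j, Φ i j = ((Fintype.card κ : ℝ))⁻¹ • ∑ k, mlog (P i * exp (a j) * B k))
    (hP : ∀ i, ‖P i - 1‖ ≤ 1 / 20) (ha : ∀ j, ‖a j‖ ≤ 1 / 20) (hB : ∀ k, ‖B k - 1‖ ≤ 1 / 20) (i i' j j' : ι) :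
    ‖Φ i j - Φ i j' - Φ i' j + Φ i' j'‖ ≤ 256 * ‖P i - P i'‖ * ‖a j - a j'‖ := by
  simp only [hΦ]
  exact norm_mixedDiff_mean_le _ _ _ _ fun k => norm_mixedDiff_mlog_le (hP i) (hP i') (ha j) (ha j') (hB k)

/-- ★★ **COUPLING COST OF A TWO-SLOT WORD MEAN**: for EVERY bijection `σ` of the member index set and EVERY centre `c`, with `‖a_j − a_{j′}‖ ≤ s`:
`‖n⁻¹Σ_i Φ i (σ i) − n⁻²Σ_{i,j} Φ i j‖ ≤ 512·s·(n⁻¹Σ_i ‖P_i − c‖)` — replacing the independent pair (context member, next member) by the COUPLED pair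
costs (size of the next slot) × (mean fluctuation of the context slot): chargeable × small (UV3-NODE §57.8 (C)(2)). [cite: Balaban1987RG1, (0.4)-(0.8) p.253] -/
theorem norm_coupled_sub_indep_wordMean_le [Nonempty ι] [Nonempty κ] (P a : ι → 𝔸) (B : κ → 𝔸) (Φ : ι → ι → 𝔸)
    (hΦ : ∀ i j, Φ i j = ((Fintype.card κ : ℝ))⁻¹ • ∑ k, mlog (P i * exp (a j) * B k))
    (hP : ∀ i, ‖P i - 1‖ ≤ 1 / 20) (ha : ∀ j, ‖a j‖ ≤ 1 / 20) (hB : ∀ k, ‖B k - 1‖ ≤ 1 / 20)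
    (σ : Equiv.Perm ι) (c : 𝔸) {s : ℝ} (hs : ∀ j j', ‖a j - a j'‖ ≤ s) :
    ‖((Fintype.card ι : ℝ))⁻¹ • ∑ i, Φ i (σ i) - ((Fintype.card ι : ℝ) ^ 2)⁻¹ • ∑ i, ∑ j, Φ i j‖ ≤
      2 * 256 * s * (((Fintype.card ι : ℝ))⁻¹ * ∑ i, ‖P i - c‖) := by
  refine norm_mean_coupled_sub_mean_indep_le Φ σ (C := 256) (α := fun i => ‖P i - c‖) (s := s) fun i i' j j' => ?_
  refine (norm_mixedDiff_wordMean_le P a B Φ hΦ hP ha hB i i' j j').trans ?_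
  have h1 : ‖P i - P i'‖ ≤ ‖P i - c‖ + ‖P i' - c‖ := by
    calc ‖P i - P i'‖ = ‖(P i - c) - (P i' - c)‖ := by rw [sub_sub_sub_cancel_right]
      _ ≤ ‖P i - c‖ + ‖P i' - c‖ := norm_sub_le _ _
  have hs0 : 0 ≤ s := (norm_nonneg _).trans (hs j j')
  have h2 := hs j j'
  calc 256 * ‖P i - P i'‖ * ‖a j - a j'‖ ≤ 256 * (‖P i - c‖ + ‖P i' - c‖) * s := by gcongr
    _ = 256 * (‖P i - c‖ + ‖P i' - c‖) * s := rfl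

end Banach

/-! ## §3 `SU(N)` clothes: contexts `U_i·S`, members `W_j`, sizes in `dist1` -/

section SUN

variable {n : Type*} [Fintype n] [DecidableEq n] [Nonempty n]
variable {ι κ : Type*} [Fintype ι] [Fintype κ]

/-- ★★ **COUPLING COST, `SU(N)` EDITION**: `U, W : ι → SU(N)` (the members of two consecutive averaged bonds), a comb factor `S ∈ SU(N)`, rest factors `B_k`
with `‖B_k − 1‖ ≤ 1∕20`, `dist1 (U_i·S) ≤ 1∕20`, `dist1 W_j ≤ ρ ≤ 1∕41`; `Φ i j = mean_k log(U_i·S·W_j·B_k)`.  Then for every bijection `σ` and centre `c`: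
`‖n⁻¹Σ_i Φ i (σ i) − n⁻²Σ_{i,j} Φ i j‖ ≤ 1024·(ρ∕(1−ρ))·(n⁻¹Σ_i ‖U_i − c‖)` (`W_j = exp(log W_j)`, `‖log W_j‖ ≤ ρ∕(1−ρ)`, right multiplication by `S` is an
isometry). [cite: Balaban1987RG1, (0.4)-(0.8) p.253] -/
theorem norm_coupled_sub_indep_wordMean_SU_le [Nonempty ι] [Nonempty κ]
    (U W : ι → Matrix.specialUnitaryGroup n ℂ) (S : Matrix.specialUnitaryGroup n ℂ) (B : κ → Matrix n n ℂ) (Φ : ι → ι → Matrix n n ℂ)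
    (hΦ : ∀ i j, Φ i j = ((Fintype.card κ : ℝ))⁻¹ • ∑ k, mlog ((U i : Matrix n n ℂ) * (S : Matrix n n ℂ) * (W j : Matrix n n ℂ) * B k))
    {ρ : ℝ} (hUS : ∀ i, dist1 (U i * S) ≤ 1 / 20) (hW : ∀ j, dist1 (W j) ≤ ρ) (hρ : ρ ≤ 1 / 41) (hB : ∀ k, ‖B k - 1‖ ≤ 1 / 20)
    (σ : Equiv.Perm ι) (c : Matrix n n ℂ) :
    ‖((Fintype.card ι : ℝ))⁻¹ • ∑ i, Φ i (σ i) - ((Fintype.card ι : ℝ) ^ 2)⁻¹ • ∑ i, ∑ j, Φ i j‖ ≤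
      1024 * (ρ / (1 - ρ)) * (((Fintype.card ι : ℝ))⁻¹ * ∑ i, ‖(U i : Matrix n n ℂ) - c‖) := by
  have hρ0 : 0 ≤ ρ := (GaugeGroup.dist1_nonneg _).trans (hW (Classical.arbitrary ι))
  have hWn : ∀ j, ‖(W j : Matrix n n ℂ) - 1‖ ≤ ρ := fun j => hW j
  -- the data of §2
  set P : ι → Matrix n n ℂ := fun i => (U i : Matrix n n ℂ) * (S : Matrix n n ℂ) with hPdef
  set a : ι → Matrix n n ℂ := fun j => mlog (W j : Matrix n n ℂ) with hadef
  have hP : ∀ i, ‖P i - 1‖ ≤ 1 / 20 := fun i => by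
    have h : ‖((U i * S : Matrix.specialUnitaryGroup n ℂ) : Matrix n n ℂ) - 1‖ ≤ 1 / 20 := hUS i
    rwa [Submonoid.coe_mul] at h
  have ha' : ∀ j, ‖a j‖ ≤ ρ / (1 - ρ) := fun j => by
    have h1 : ‖(W j : Matrix n n ℂ) - 1‖ < 1 := (hWn j).trans_lt (by linarith)
    refine (norm_mlog_le_div h1).trans ?_
    rw [div_le_div_iff₀ (by linarith) (by linarith)]; nlinarith [hWn j, norm_nonneg ((W j : Matrix n n ℂ) - 1)]
  have hρ' : ρ / (1 - ρ) ≤ 1 / 40 := by rw [div_le_div_iff₀ (by linarith) (by norm_num)]; linarith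
  have ha : ∀ j, ‖a j‖ ≤ 1 / 20 := fun j => (ha' j).trans (by linarith)
  have hs : ∀ j j', ‖a j - a j'‖ ≤ 2 * (ρ / (1 - ρ)) := fun j j' => (norm_sub_le _ _).trans (by linarith [ha' j, ha' j'])
  have hexpW : ∀ j, exp (a j) = (W j : Matrix n n ℂ) := fun j => exp_mlog ((hWn j).trans_lt (by linarith))
  have hΦ' : ∀ i j, Φ i j = ((Fintype.card κ : ℝ))⁻¹ • ∑ k, mlog (P i * exp (a j) * B k) := fun i j => by
    simp only [hΦ, P, hexpW]
  have hmain := norm_coupled_sub_indep_wordMean_le P a B Φ hΦ' hP ha hB σ (c * (S : Matrix n n ℂ)) hs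
  -- right multiplication by the unitary `S` is an isometry
  have hiso : ∀ i, ‖P i - c * (S : Matrix n n ℂ)‖ = ‖(U i : Matrix n n ℂ) - c‖ := fun i => by
    simp only [P]
    rw [← sub_mul, CStarRing.norm_mul_mem_unitary _ (Matrix.specialUnitaryGroup_le_unitaryGroup S.2)]
  simp only [hiso] at hmain
  refine hmain.trans (le_of_eq ?_)
  ring

end SUN

end Summit.QuantumFields.YangMills.Theorems.FluctuationComparisonRegPrIntLS2BetaCouplingCost

end
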